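import Literature.NumberTheory.LFunctions.NymanBeurlingVectors
import Literature.NumberTheory.LFunctions.EulerMaclaurinZeta
import Literature.Analysis.Complex.VerticalLineShift
import Mathlib.Analysis.Analytic.IsolatedZeros
import Mathlib.MeasureTheory.Integral.Asymptotics
import HarnessLib

/-!
# Burnol's vectors are orthogonal to `𝓑_λ`

Continuation of `Literature/NumberTheory/LFunctions/NymanBeurlingVectors.lean`. For a zero
`ρ = 1/2 + iγ` of `ζ` on the critical line, `0 < λ ≤ θ ≤ 1`, and `s = 1/2 + iτ`, we prove

  `∫ 𝓜[{θ/t}](s) · burnolK ρ λ s dτ = 0`,   `𝓜[{θ/t}](s) = -θ^s ζ(s)/s`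

(`integral_mellin_fract_mul_burnolK_eq_zero`), i.e. (by the Parseval pairing of the previous
file) the vector `𝓜⁻¹(conj ∘ burnolK ρ λ)` is orthogonal in `L²(0,∞)` to every generator
`t ↦ {θ/t}` of `𝓑_λ` — Burnol's Theorem 4.2/Corollary 4.3 for `k = 0`, here obtained without
the operator calculus: on the line

  `θ^s (-ζ(s)/s) burnolK ρ λ s = h_R(s) + (λ^ρ/V(ρ)) h_L(s)`,
  `h_R(s) = θ^s ζ₁(s) / (s⁵ (s-ρ))`,  `h_L(s) = y^s ζ₁(1-s) / ((s-1)⁵ (s-ρ))`,  `y = θ/λ ≥ 1`,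

with `ζ₁(s) = (s-1)ζ(s)` Mathlib's entire `riemannZeta₁` (functional equation
`ζ(1-s) = gammaRatio(s) ζ(s)`); `h_R` is holomorphic on `re s > 0` and `h_L` on `re s < 1`
(`ζ₁(ρ) = ζ₁(1-ρ) = 0`), both are `O(|s|⁻²)` on vertical strips by the Euler–Maclaurin bound
`‖ζ(s)‖ ≪ |s|³` (`Literature.NumberTheory.LFunctions.norm_riemannZeta_le_of_neg_one_le_re`), so the
lines of integration may be moved to `re s = 2`, resp. `re s = -1`
(`Literature.Analysis.Complex.integral_vertical_eq_of_differentiableOn`), where the Dirichlet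
series for `ζ(s)`, resp. `ζ(1-s)`, converge absolutely and every term integrates to `0` by closing
the contour to the right (`(θ/n)^s`, `θ/n ≤ 1`), resp. to the left (`(yn)^s`, `yn ≥ 1`)
(`Literature.Analysis.Complex.integral_vertical_mul_cpow_eq_zero_of_le_one` / `_of_one_le`).
No poles are crossed anywhere.

## References

* J.-F. Burnol, *A lower bound in an approximation problem involving the zeros of the Riemann
  zeta function*, Adv. Math. 170 (2002), 56–70; arXiv:math/0103058, Thm. 4.2, Cor. 4.3.
-/

noncomputable section

open Complex Filter MeasureTheory Set Asymptotics
open scoped Real Topology ComplexConjugate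

namespace Literature.NumberTheory.LFunctions

namespace BurnolVectors

/-! ## Generalities: `dslope` of an entire function, a polynomial bound for `ζ₁`, integrability
on lines -/

/-- The `dslope` of an entire function is entire (at the base point by the power series). [folklore] -/
theorem differentiable_dslope {f : ℂ → ℂ} (hf : Differentiable ℂ f) (a : ℂ) :
    Differentiable ℂ (dslope f a) := by
  intro b
  rcases eq_or_ne b a with rfl | hb
  · obtain ⟨p, hp⟩ := hf.analyticAt b
    exact hp.has_fpower_series_dslope_fslope.analyticAt.differentiableAt
  · exact (differentiableAt_dslope_of_ne hb).2 (hf b)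

/-- Off the base point, `dslope f a b = f(b)/(b-a)` when `f(a) = 0`. [folklore] -/
theorem dslope_eq_div {f : ℂ → ℂ} {a b : ℂ} (hfa : f a = 0) (hb : b ≠ a) :
    dslope f a b = f b / (b - a) := by
  rw [dslope_of_ne f hb, slope_def_field, hfa, sub_zero]

/-- **Polynomial growth of `ζ₁(s) = (s-1)ζ(s)` on `re s ≥ -1`**: `‖ζ₁(s)‖ ≤ (‖s‖ + 2)⁴` (from the
Euler–Maclaurin bound `Literature.NumberTheory.LFunctions.norm_riemannZeta_le_of_neg_one_le_re`).
[cite: Edwards1974, §6.4 eq. (1)] -/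
theorem norm_riemannZeta₁_le {s : ℂ} (hs : -1 ≤ s.re) : ‖riemannZeta₁ s‖ ≤ (‖s‖ + 2) ^ 4 := by
  rcases eq_or_ne s 1 with rfl | hs1
  · rw [riemannZeta₁_one]; norm_num
  have hζ := norm_riemannZeta_le_of_neg_one_le_re hs hs1
  have heq : riemannZeta₁ s = (s - 1) * riemannZeta s := by
    rw [riemannZeta_eq_inv_sub_mul hs1, ← mul_assoc, mul_inv_cancel₀ (sub_ne_zero.2 hs1), one_mul]
  rw [heq, norm_mul]
  set m := ‖s‖ with hm
  have hm0 : 0 ≤ m := norm_nonneg _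
  have h1 : ‖s - 1‖ ≤ m + 1 := (norm_sub_le _ _).trans (by simp [hm])
  have h2 : ‖s + 1‖ ≤ m + 1 := (norm_add_le _ _).trans (by simp [hm])
  have h3 : ‖s + 2‖ ≤ m + 2 := (norm_add_le _ _).trans (by simp [hm])
  have h0 : 0 < ‖s - 1‖ := norm_pos_iff.2 (sub_ne_zero.2 hs1)
  calc ‖s - 1‖ * ‖riemannZeta s‖
      ≤ ‖s - 1‖ * (1 / ‖s - 1‖ + 1 / 2 + m / 12 + m * ‖s + 1‖ * ‖s + 2‖ / 48) := by gcongr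
    _ = 1 + ‖s - 1‖ * (1 / 2 + m / 12 + m * ‖s + 1‖ * ‖s + 2‖ / 48) := by field_simp; ring
    _ ≤ 1 + (m + 1) * (1 / 2 + m / 12 + m * (m + 1) * (m + 2) / 48) := by gcongr
    _ ≤ (m + 2) ^ 4 := by
        have e : (m + 2) ^ 4 - (1 + (m + 1) * (1 / 2 + m / 12 + m * (m + 1) * (m + 2) / 48)) =
            29 / 2 + 753 / 24 * m + 1143 / 48 * m ^ 2 + 95 / 12 * m ^ 3 + 47 / 48 * m ^ 4 := by ring
        nlinarith [e, pow_nonneg hm0 2, pow_nonneg hm0 3, pow_nonneg hm0 4]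

/-- A continuous function on `ℝ` which is `≤ C (1+y²)⁻¹` for `|y| ≥ T` is integrable. [folklore] -/
theorem integrable_of_continuous_of_norm_le {F : ℝ → ℂ} (hF : Continuous F) {T C : ℝ}
    (h : ∀ y : ℝ, T ≤ |y| → ‖F y‖ ≤ C * (1 + y ^ 2)⁻¹) : Integrable F := by
  refine hF.locallyIntegrable.integrable_of_isBigO_cocompact (g := fun y : ℝ ↦ (1 + y ^ 2)⁻¹)
    ?_ (integrable_inv_one_add_sq.integrableAtFilter _)
  refine IsBigO.of_bound C ?_
  rw [cocompact_eq_atBot_atTop, eventually_sup]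
  constructor
  · filter_upwards [eventually_le_atBot (min (-T) 0)] with y hy
    have hy' : T ≤ |y| := by
      rw [abs_of_nonpos (le_trans hy (min_le_right _ _))]; linarith [min_le_left (-T) 0]
    rw [Real.norm_of_nonneg (by positivity)]
    exact h y hy'
  · filter_upwards [eventually_ge_atTop (max T 0)] with y hy
    have hy' : T ≤ |y| := by
      rw [abs_of_nonneg (le_trans (le_max_right _ _) hy)]; exact le_trans (le_max_left _ _) hy
    rw [Real.norm_of_nonneg (by positivity)]
    exact h y hy'

/-- `‖σ + iy‖ ≥ |y|`. [folklore] -/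
private lemma abs_le_norm_line (σ y : ℝ) : |y| ≤ ‖(σ : ℂ) + y * I‖ := by
  simpa using abs_im_le_norm ((σ : ℂ) + y * I)

/-- From `‖F‖ ≤ C/‖s‖²` at large height to the `(1+y²)⁻¹` majorant along `re s = σ`. [folklore] -/
lemma norm_le_inv_one_add_sq_of_le {F : ℂ → ℂ} {σ T C y : ℝ} (hC : 0 ≤ C) (hT : 1 ≤ T)
    (h : T ≤ ‖(σ : ℂ) + y * I‖ → ‖F ((σ : ℂ) + y * I)‖ ≤ C / ‖(σ : ℂ) + y * I‖ ^ 2)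
    (hy : T ≤ |y|) :
    ‖F ((σ : ℂ) + y * I)‖ ≤ 2 * C * (1 + y ^ 2)⁻¹ := by
  have hs : T ≤ ‖(σ : ℂ) + y * I‖ := hy.trans (abs_le_norm_line σ y)
  have hy1 : 1 ≤ |y| := hT.trans hy
  refine (h hs).trans ?_
  have hn : y ^ 2 ≤ ‖(σ : ℂ) + y * I‖ ^ 2 := by
    rw [← sq_abs y]; exact pow_le_pow_left₀ (abs_nonneg _) (abs_le_norm_line σ y) 2
  have hy2 : 1 ≤ y ^ 2 := by rw [← sq_abs y]; nlinarith
  have hpos : 0 < ‖(σ : ℂ) + y * I‖ := by linarith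
  rw [← div_eq_mul_inv, div_le_div_iff₀ (by positivity) (by positivity)]
  nlinarith [mul_le_mul_of_nonneg_left hn hC, mul_le_mul_of_nonneg_left hy2 hC]


/-- Continuity along a vertical line of a function differentiable at each of its points.
[folklore] -/
lemma continuous_line_of_differentiableAt {F : ℂ → ℂ} (σ : ℝ)
    (h : ∀ y : ℝ, DifferentiableAt ℂ F ((σ : ℂ) + y * I)) :
    Continuous fun y : ℝ ↦ F ((σ : ℂ) + y * I) := by
  have hline : Continuous fun y : ℝ ↦ (σ : ℂ) + y * I := by fun_prop
  refine continuous_iff_continuousAt.2 fun y ↦ ?_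
  have h1 : ContinuousAt F ((fun y : ℝ ↦ (σ : ℂ) + y * I) y) := (h y).continuousAt
  exact ContinuousAt.comp (f := fun y : ℝ ↦ (σ : ℂ) + y * I) h1 hline.continuousAt

/-- Uniform smallness on horizontal segments from an `O(‖s‖⁻²)` bound at large height.
[folklore] -/
lemma horizontal_decay_of_le {F : ℂ → ℂ} {a b T C : ℝ} (hT : 1 ≤ T)
    (h : ∀ s : ℂ, a ≤ s.re → s.re ≤ b → T ≤ ‖s‖ → ‖F s‖ ≤ C / ‖s‖ ^ 2) :
    ∀ ε : ℝ, 0 < ε → ∃ T₀ : ℝ, ∀ t : ℝ, T₀ ≤ |t| → ∀ x ∈ Icc a b, ‖F (x + t * I)‖ ≤ ε := by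
  intro ε hε
  refine ⟨max T (C / ε + 1), fun t ht x hx ↦ ?_⟩
  have ht1 : T ≤ |t| := le_of_max_le_left ht
  have ht2 : C / ε + 1 ≤ |t| := le_of_max_le_right ht
  have hs : T ≤ ‖(x : ℂ) + t * I‖ := ht1.trans (abs_le_norm_line x t)
  have hspos : 0 < ‖(x : ℂ) + t * I‖ := by linarith
  refine (h _ (by simpa using hx.1) (by simpa using hx.2) hs).trans ?_
  rw [div_le_iff₀ (by positivity)]
  have h1 : |t| ^ 2 ≤ ‖(x : ℂ) + t * I‖ ^ 2 := pow_le_pow_left₀ (abs_nonneg _) (abs_le_norm_line x t) 2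
  have h2 : |t| ≤ |t| ^ 2 := by nlinarith
  have h3 : C < ε * |t| := by
    have : C = ε * (C / ε) := by field_simp
    nlinarith
  nlinarith

/-! ## The right part `h_R(s) = θ^s ζ₁(s) / (s⁵ (s - ρ))` -/

/-- `h_R(s) = θ^s · dslope ζ₁ ρ s / s⁵` (`= θ^s ζ₁(s)/(s⁵(s-ρ))` off `ρ` when `ζ₁(ρ) = 0`).
[cite: Burnol2002, Thm. 4.2 (proof)] -/
def partR (θ : ℝ) (ρ : ℂ) (s : ℂ) : ℂ :=
  (θ : ℂ) ^ s * dslope riemannZeta₁ ρ s / s ^ 5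

/-- `h_R` off the base point. [folklore] -/
theorem partR_eq {θ : ℝ} {ρ s : ℂ} (hζ : riemannZeta₁ ρ = 0) (hs : s ≠ ρ) :
    partR θ ρ s = (θ : ℂ) ^ s * riemannZeta₁ s / (s ^ 5 * (s - ρ)) := by
  rw [partR, dslope_eq_div hζ hs, ← mul_div_assoc, div_div, mul_comm (s - ρ)]

/-- `h_R` in terms of `ζ`: `θ^s (s-1)ζ(s)/(s⁵(s-ρ))` for `s ≠ ρ, 1`. [folklore] -/
theorem partR_eq_zeta {θ : ℝ} {ρ s : ℂ} (hζ : riemannZeta₁ ρ = 0) (hs : s ≠ ρ) (hs1 : s ≠ 1) :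
    partR θ ρ s = (θ : ℂ) ^ s * ((s - 1) * riemannZeta s) / (s ^ 5 * (s - ρ)) := by
  rw [partR_eq hζ hs, riemannZeta_eq_inv_sub_mul hs1, ← mul_assoc (s - 1),
    mul_inv_cancel₀ (sub_ne_zero.2 hs1), one_mul]

/-- `h_R` is complex differentiable away from `s = 0` (for `θ > 0`). [folklore] -/
theorem differentiableAt_partR {θ : ℝ} (hθ : 0 < θ) (ρ : ℂ) {s : ℂ} (hs : s ≠ 0) :
    DifferentiableAt ℂ (partR θ ρ) s := by
  unfold partR
  refine DifferentiableAt.div (DifferentiableAt.mul ?_ ?_) (by fun_prop) (pow_ne_zero _ hs)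
  · exact differentiableAt_id.const_cpow (Or.inl (by exact_mod_cast hθ.ne'))
  · exact differentiable_dslope differentiable_riemannZeta₁ ρ s

/-- **Decay of `h_R`**: for `0 < θ ≤ 1`, `0 ≤ re s`, `‖s‖ ≥ max 2 (2‖ρ‖)`:
`‖h_R(s)‖ ≤ 32/‖s‖²`. [folklore] -/
theorem norm_partR_le {θ : ℝ} (hθ : 0 < θ) (hθ1 : θ ≤ 1) {ρ : ℂ} (hζ : riemannZeta₁ ρ = 0)
    (hρ : ρ ≠ 0) {s : ℂ} (hs0 : 0 ≤ s.re) (hs : max 2 (2 * ‖ρ‖) ≤ ‖s‖) :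
    ‖partR θ ρ s‖ ≤ 32 / ‖s‖ ^ 2 := by
  have h2 : 2 ≤ ‖s‖ := le_of_max_le_left hs
  have h2ρ : 2 * ‖ρ‖ ≤ ‖s‖ := le_of_max_le_right hs
  have hρpos : 0 < ‖ρ‖ := norm_pos_iff.2 hρ
  have hsρ : s ≠ ρ := by
    intro h; rw [h] at h2ρ; linarith
  have hspos : 0 < ‖s‖ := by linarith
  rw [partR_eq hζ hsρ, norm_div, norm_mul, norm_mul, norm_pow,
    norm_cpow_eq_rpow_re_of_pos hθ]
  -- the pieces
  have hθs : θ ^ s.re ≤ 1 := Real.rpow_le_one hθ.le hθ1 hs0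
  have hζ1 : ‖riemannZeta₁ s‖ ≤ (‖s‖ + 2) ^ 4 :=
    norm_riemannZeta₁_le (by linarith [abs_re_le_norm s, abs_le.1 (abs_re_le_norm s)])
  have hζ2 : (‖s‖ + 2) ^ 4 ≤ 16 * ‖s‖ ^ 4 := by
    have : ‖s‖ + 2 ≤ 2 * ‖s‖ := by linarith
    calc (‖s‖ + 2) ^ 4 ≤ (2 * ‖s‖) ^ 4 := pow_le_pow_left₀ (by positivity) this 4
      _ = 16 * ‖s‖ ^ 4 := by ring
  have hsub : ‖s‖ / 2 ≤ ‖s - ρ‖ := by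
    have := norm_sub_norm_le s ρ
    have h' : ‖s‖ - ‖ρ‖ ≤ ‖s - ρ‖ := by linarith [abs_norm_sub_norm_le s ρ, le_abs_self (‖s‖ - ‖ρ‖)]
    linarith
  have hsρpos : 0 < ‖s - ρ‖ := by linarith
  rw [div_le_div_iff₀ (mul_pos (pow_pos hspos 5) hsρpos) (pow_pos hspos 2)]
  calc θ ^ s.re * ‖riemannZeta₁ s‖ * ‖s‖ ^ 2 ≤ 1 * (16 * ‖s‖ ^ 4) * ‖s‖ ^ 2 := by
        gcongr; exact hζ1.trans hζ2
    _ = 32 * (‖s‖ ^ 5 * (‖s‖ / 2)) := by ring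
    _ ≤ 32 * (‖s‖ ^ 5 * ‖s - ρ‖) := by gcongr

/-- `h_R` is integrable along every line `re s = σ > 0` (for `0 < θ ≤ 1`). [folklore] -/
theorem integrable_partR_line {θ : ℝ} (hθ : 0 < θ) (hθ1 : θ ≤ 1) {ρ : ℂ} (hζ : riemannZeta₁ ρ = 0)
    (hρ : ρ ≠ 0) {σ : ℝ} (hσ : 0 < σ) :
    Integrable fun y : ℝ ↦ partR θ ρ ((σ : ℂ) + y * I) := by
  have hcont : Continuous fun y : ℝ ↦ partR θ ρ ((σ : ℂ) + y * I) :=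
    continuous_line_of_differentiableAt σ fun y ↦ differentiableAt_partR hθ ρ fun h ↦ by
      have := congrArg Complex.re h; simp at this; linarith
  refine integrable_of_continuous_of_norm_le hcont (T := max 2 (2 * ‖ρ‖)) (C := 2 * 32) fun y hy ↦ ?_
  exact norm_le_inv_one_add_sq_of_le (by norm_num) (le_trans (by norm_num) (le_max_left _ _))
    (fun hs ↦ norm_partR_le hθ hθ1 hζ hρ (by simp; exact hσ.le) hs) hy



/-- Points with `re s = 1/2 ≤ …`: a zero `ρ` on the critical line is `≠ 0`. [folklore] -/
lemma ne_zero_of_re_eq_half {ρ : ℂ} (hρ : ρ.re = 1 / 2) : ρ ≠ 0 := fun h ↦ by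
  rw [h] at hρ; simp at hρ

/-- **Shifting `h_R` from the critical line to `re s = 2`** (no singularities in
`0 < re s`; horizontal sides `O(T⁻²)`). [folklore] -/
theorem integral_partR_half_eq_two {θ : ℝ} (hθ : 0 < θ) (hθ1 : θ ≤ 1) {ρ : ℂ}
    (hζ : riemannZeta₁ ρ = 0) (hρ : ρ.re = 1 / 2) :
    ∫ y : ℝ, partR θ ρ (((1 / 2 : ℝ) : ℂ) + y * I) = ∫ y : ℝ, partR θ ρ (((2 : ℝ) : ℂ) + y * I) := by
  have hρ0 := ne_zero_of_re_eq_half hρ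
  refine Literature.Analysis.Complex.integral_vertical_eq_of_differentiableOn (by norm_num) ?_
    (integrable_partR_line hθ hθ1 hζ hρ0 (by norm_num))
    (integrable_partR_line hθ hθ1 hζ hρ0 (by norm_num)) ?_
  · intro s hs
    refine (differentiableAt_partR hθ ρ fun h ↦ ?_).differentiableWithinAt
    have h1 : (1 / 2 : ℝ) ≤ s.re := hs.1
    rw [h, zero_re] at h1
    norm_num at h1
  · exact horizontal_decay_of_le (le_trans (by norm_num) (le_max_left 2 (2 * ‖ρ‖)))
      fun s ha _ hs ↦ norm_partR_le hθ hθ1 hζ hρ0 (by linarith) hs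

/-- The rational kernel `q_R(s) = (s-1)/(s⁵(s-ρ))` of the right part. [folklore] -/
def qR (ρ : ℂ) (s : ℂ) : ℂ :=
  (s - 1) / (s ^ 5 * (s - ρ))

/-- `q_R` is complex differentiable away from `0` and `ρ`. [folklore] -/
theorem differentiableAt_qR {ρ s : ℂ} (hs0 : s ≠ 0) (hsρ : s ≠ ρ) : DifferentiableAt ℂ (qR ρ) s := by
  unfold qR
  exact DifferentiableAt.div (by fun_prop) (by fun_prop)
    (mul_ne_zero (pow_ne_zero _ hs0) (sub_ne_zero.2 hsρ))

/-- `q_R` is complex differentiable on `re s ≥ 2` (poles at `0` and `ρ`, `re ρ = 1/2`). [folklore] -/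
theorem differentiableOn_qR {ρ : ℂ} (hρ : ρ.re = 1 / 2) :
    DifferentiableOn ℂ (qR ρ) {s : ℂ | 2 ≤ s.re} := by
  intro s hs
  simp only [mem_setOf_eq] at hs
  have hs0 : s ≠ 0 := fun h ↦ by rw [h] at hs; simp at hs; linarith
  have hsρ : s ≠ ρ := fun h ↦ by rw [h, hρ] at hs; norm_num at hs
  exact (differentiableAt_qR hs0 hsρ).differentiableWithinAt

/-- `‖q_R(s)‖ ≤ 1/‖s‖²` on `re s ≥ 2`. [folklore] -/
theorem norm_qR_le {ρ : ℂ} (hρ : ρ.re = 1 / 2) {s : ℂ} (hs : 2 ≤ s.re) :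
    ‖qR ρ s‖ ≤ 1 / ‖s‖ ^ 2 := by
  have hns : 2 ≤ ‖s‖ := hs.trans (re_le_norm s)
  have hsρ : 3 / 2 ≤ ‖s - ρ‖ := by
    have := re_le_norm (s - ρ)
    rw [sub_re, hρ] at this
    linarith
  have h1 : ‖s - 1‖ ≤ ‖s‖ + 1 := (norm_sub_le _ _).trans (by simp)
  have hspos : 0 < ‖s‖ := by linarith
  rw [qR, norm_div, norm_mul, norm_pow,
    div_le_div_iff₀ (mul_pos (pow_pos hspos 5) (by linarith)) (pow_pos hspos 2), one_mul]
  have h4 : ‖s‖ ^ 2 * 4 ≤ ‖s‖ ^ 4 := by nlinarith [pow_le_pow_left₀ (by norm_num) hns 2]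
  calc ‖s - 1‖ * ‖s‖ ^ 2 ≤ (‖s‖ + 1) * ‖s‖ ^ 2 := by gcongr
    _ ≤ (2 * ‖s‖) * ‖s‖ ^ 2 := by gcongr; linarith
    _ = ‖s‖ ^ 3 * 2 := by ring
    _ ≤ ‖s‖ ^ 3 * (‖s‖ ^ 2 * (3 / 2)) := by gcongr; nlinarith
    _ = ‖s‖ ^ 5 * (3 / 2) := by ring
    _ ≤ ‖s‖ ^ 5 * ‖s - ρ‖ := by gcongr

/-- Splitting a positive real base: `(θ/(n+1))^s = θ^s · (1/(n+1)^s)`. [folklore] -/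
lemma cpow_div_natSucc {θ : ℝ} (hθ : 0 ≤ θ) (n : ℕ) (s : ℂ) :
    ((θ / (n + 1) : ℝ) : ℂ) ^ s = (θ : ℂ) ^ s * (1 / ((n : ℂ) + 1) ^ s) := by
  have hn : (0 : ℝ) ≤ (n + 1 : ℝ)⁻¹ := by positivity
  have harg : ((n + 1 : ℝ) : ℂ).arg ≠ π := by
    rw [arg_ofReal_of_nonneg (by positivity)]; exact Real.pi_ne_zero.symm
  rw [div_eq_mul_inv, show ((θ * (n + 1 : ℝ)⁻¹ : ℝ) : ℂ) = (θ : ℂ) * (((n + 1 : ℝ)⁻¹ : ℝ) : ℂ) by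
    push_cast; ring, mul_cpow_ofReal_nonneg hθ hn, ofReal_inv, inv_cpow _ _ harg]
  push_cast
  ring

/-- **`h_R` on `re s = 2` as an absolutely convergent series**:
`h_R(s) = ∑_n q_R(s) (θ/(n+1))^s`. [folklore] -/
theorem partR_two_eq_tsum {θ : ℝ} (hθ : 0 < θ) {ρ : ℂ} (hζ : riemannZeta₁ ρ = 0)
    (hρ : ρ.re = 1 / 2) (y : ℝ) :
    partR θ ρ (((2 : ℝ) : ℂ) + y * I) =
      ∑' n : ℕ, qR ρ (((2 : ℝ) : ℂ) + y * I) * ((θ / (n + 1) : ℝ) : ℂ) ^ (((2 : ℝ) : ℂ) + y * I) := by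
  set s : ℂ := ((2 : ℝ) : ℂ) + y * I with hsdef
  have hsre : s.re = 2 := by simp [hsdef]
  have hsρ : s ≠ ρ := fun h ↦ by rw [h] at hsre; rw [hρ] at hsre; norm_num at hsre
  have hs1 : s ≠ 1 := fun h ↦ by rw [h] at hsre; simp at hsre
  rw [partR_eq_zeta hζ hsρ hs1, zeta_eq_tsum_one_div_nat_add_one_cpow (by rw [hsre]; norm_num)]
  have e : ∀ n : ℕ, qR ρ s * ((θ / (n + 1) : ℝ) : ℂ) ^ s =
      ((θ : ℂ) ^ s * (s - 1) / (s ^ 5 * (s - ρ))) * (1 / ((n : ℂ) + 1) ^ s) := by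
    intro n
    rw [cpow_div_natSucc hθ.le, qR]
    ring
  simp_rw [e]
  rw [tsum_mul_left]
  ring

/-- The terms of the series for `h_R` on `re s = 2` are integrable, with
`∫ ‖q_R(s)(θ/(n+1))^s‖ dy ≤ π θ²/(n+1)²`-type summable bounds. [folklore] -/
theorem integrable_qR_mul_cpow {θ : ℝ} (hθ : 0 < θ) {ρ : ℂ} (hρ : ρ.re = 1 / 2) (n : ℕ) :
    Integrable (fun y : ℝ ↦ qR ρ (((2 : ℝ) : ℂ) + y * I) * ((θ / (n + 1) : ℝ) : ℂ) ^ (((2 : ℝ) : ℂ) + y * I)) ∧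
      ∫ y : ℝ, ‖qR ρ (((2 : ℝ) : ℂ) + y * I) * ((θ / (n + 1) : ℝ) : ℂ) ^ (((2 : ℝ) : ℂ) + y * I)‖ ≤
        (θ / (n + 1)) ^ 2 * π := by
  have hx : 0 < θ / (n + 1) := by positivity
  have hbound : ∀ y : ℝ, ‖qR ρ (((2 : ℝ) : ℂ) + y * I) * ((θ / (n + 1) : ℝ) : ℂ) ^ (((2 : ℝ) : ℂ) + y * I)‖ ≤
      (θ / (n + 1)) ^ 2 * (1 + y ^ 2)⁻¹ := by
    intro y
    rw [norm_mul, norm_cpow_eq_rpow_re_of_pos hx, mul_comm]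
    have hre : (((2 : ℝ) : ℂ) + y * I).re = 2 := by simp
    rw [hre, Real.rpow_two]
    gcongr
    refine (norm_qR_le hρ (by rw [hre])).trans ?_
    have hpos : 0 < ‖((2 : ℝ) : ℂ) + y * I‖ := by
      have := re_le_norm (((2 : ℝ) : ℂ) + y * I); rw [hre] at this; linarith
    rw [one_div, inv_le_inv₀ (pow_pos hpos 2) (by positivity), Complex.sq_norm, normSq_add_mul_I]
    nlinarith
  have hcont : Continuous fun y : ℝ ↦ qR ρ (((2 : ℝ) : ℂ) + y * I) * ((θ / (n + 1) : ℝ) : ℂ) ^ (((2 : ℝ) : ℂ) + y * I) := by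
    refine Continuous.mul ?_ ?_
    · refine continuous_line_of_differentiableAt 2 fun y ↦ differentiableAt_qR ?_ ?_
      · intro h; have := congrArg Complex.re h; simp at this
      · intro h; have := congrArg Complex.re h; rw [hρ] at this; simp at this; norm_num at this
    · exact continuous_line_of_differentiableAt 2 fun y ↦
        differentiableAt_id.const_cpow (Or.inl (by exact_mod_cast hx.ne'))
  have hint : Integrable fun y : ℝ ↦ qR ρ (((2 : ℝ) : ℂ) + y * I) * ((θ / (n + 1) : ℝ) : ℂ) ^ (((2 : ℝ) : ℂ) + y * I) :=
    integrable_of_continuous_of_norm_le hcont (T := 0) fun y _ ↦ hbound y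
  refine ⟨hint, ?_⟩
  calc ∫ y : ℝ, ‖qR ρ (((2 : ℝ) : ℂ) + y * I) * ((θ / (n + 1) : ℝ) : ℂ) ^ (((2 : ℝ) : ℂ) + y * I)‖
      ≤ ∫ y : ℝ, (θ / (n + 1)) ^ 2 * (1 + y ^ 2)⁻¹ :=
        integral_mono hint.norm (integrable_inv_one_add_sq.const_mul _) hbound
    _ = (θ / (n + 1)) ^ 2 * π := by rw [integral_const_mul, integral_univ_inv_one_add_sq]

/-- **`∫ h_R = 0` along the critical line** (`0 < θ ≤ 1`, `ζ₁(ρ) = 0`, `re ρ = 1/2`).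
[cite: Burnol2002, Thm. 4.2 (proof)] -/
theorem integral_partR_eq_zero {θ : ℝ} (hθ : 0 < θ) (hθ1 : θ ≤ 1) {ρ : ℂ}
    (hζ : riemannZeta₁ ρ = 0) (hρ : ρ.re = 1 / 2) :
    ∫ y : ℝ, partR θ ρ (((1 / 2 : ℝ) : ℂ) + y * I) = 0 := by
  rw [integral_partR_half_eq_two hθ hθ1 hζ hρ]
  simp_rw [partR_two_eq_tsum hθ hζ hρ]
  have hsum : Summable fun n : ℕ ↦ ∫ y : ℝ,
      ‖qR ρ (((2 : ℝ) : ℂ) + y * I) * ((θ / (n + 1) : ℝ) : ℂ) ^ (((2 : ℝ) : ℂ) + y * I)‖ := by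
    have h1 : Summable fun n : ℕ ↦ (θ / (n + 1)) ^ 2 * π := by
      have := (summable_nat_add_iff 1).2 (Real.summable_one_div_nat_pow.2 one_lt_two)
      simp only [Nat.cast_add, Nat.cast_one] at this
      refine (this.mul_left (θ ^ 2 * π)).congr fun n ↦ ?_
      field_simp
    exact Summable.of_nonneg_of_le (fun n ↦ integral_nonneg fun y ↦ norm_nonneg _)
      (fun n ↦ (integrable_qR_mul_cpow hθ hρ n).2) h1
  rw [← integral_tsum_of_summable_integral_norm (fun n ↦ (integrable_qR_mul_cpow hθ hρ n).1) hsum]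
  have h0 : ∀ n : ℕ, ∫ y : ℝ, qR ρ (((2 : ℝ) : ℂ) + y * I) *
      ((θ / (n + 1) : ℝ) : ℂ) ^ (((2 : ℝ) : ℂ) + y * I) = 0 := by
    intro n
    have hx1 : θ / (n + 1) ≤ 1 := by
      rw [div_le_one (by positivity)]
      exact hθ1.trans (by simp)
    exact Literature.Analysis.Complex.integral_vertical_mul_cpow_eq_zero_of_le_one (C := 1) two_pos
      (differentiableOn_qR hρ) (fun s hs ↦ norm_qR_le hρ hs) (by positivity) hx1
  simp_rw [h0]
  exact tsum_zero


/-! ## The left part `h_L(s) = y^s ζ₁(1-s) / ((s-1)⁵ (s - ρ))` -/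

/-- `ζ₁(conj s) = conj ζ₁(s)`. [folklore] -/
theorem riemannZeta₁_conj (s : ℂ) : riemannZeta₁ (conj s) = conj (riemannZeta₁ s) := by
  rcases eq_or_ne s 1 with rfl | hs1
  · simp [riemannZeta₁_one]
  have hs1' : conj s ≠ 1 := fun h ↦ hs1 (by simpa using congrArg conj h)
  have e1 : riemannZeta₁ s = (s - 1) * riemannZeta s := by
    rw [riemannZeta_eq_inv_sub_mul hs1, ← mul_assoc, mul_inv_cancel₀ (sub_ne_zero.2 hs1), one_mul]
  have e2 : riemannZeta₁ (conj s) = (conj s - 1) * riemannZeta (conj s) := by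
    rw [riemannZeta_eq_inv_sub_mul hs1', ← mul_assoc, mul_inv_cancel₀ (sub_ne_zero.2 hs1'), one_mul]
  rw [e2, e1, riemannZeta_conj, map_mul, map_sub, map_one]

/-- For a zero `ρ` of `ζ₁` on the critical line, `ζ₁(1 - ρ) = 0` too (`1 - ρ = conj ρ`).
[folklore] -/
theorem riemannZeta₁_one_sub_eq_zero {ρ : ℂ} (hζ : riemannZeta₁ ρ = 0) (hρ : ρ.re = 1 / 2) :
    riemannZeta₁ (1 - ρ) = 0 := by
  have e : 1 - ρ = conj ρ := by
    apply Complex.ext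
    · simp [hρ]; norm_num
    · simp
  rw [e, riemannZeta₁_conj, hζ, map_zero]

/-- `h_L(s) = y^s · dslope (ζ₁ ∘ (1 - ·)) ρ s / (s-1)⁵` (`= y^s ζ₁(1-s)/((s-1)⁵(s-ρ))` off `ρ` when
`ζ₁(1-ρ) = 0`). [cite: Burnol2002, Thm. 4.2 (proof)] -/
def partL (yv : ℝ) (ρ : ℂ) (s : ℂ) : ℂ :=
  (yv : ℂ) ^ s * dslope (fun z ↦ riemannZeta₁ (1 - z)) ρ s / (s - 1) ^ 5

/-- `h_L` off the base point. [folklore] -/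
theorem partL_eq {yv : ℝ} {ρ s : ℂ} (hζ' : riemannZeta₁ (1 - ρ) = 0) (hs : s ≠ ρ) :
    partL yv ρ s = (yv : ℂ) ^ s * riemannZeta₁ (1 - s) / ((s - 1) ^ 5 * (s - ρ)) := by
  rw [partL, dslope_eq_div (f := fun z ↦ riemannZeta₁ (1 - z)) hζ' hs, ← mul_div_assoc, div_div,
    mul_comm (s - ρ)]

/-- `ζ₁(1-s) = -s ζ(1-s)` for `s ≠ 0`. [folklore] -/
theorem riemannZeta₁_one_sub {s : ℂ} (hs0 : s ≠ 0) :
    riemannZeta₁ (1 - s) = -s * riemannZeta (1 - s) := by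
  have h1 : (1 : ℂ) - s ≠ 1 := fun h ↦ hs0 (by simpa using h)
  rw [riemannZeta_eq_inv_sub_mul h1, show (1 : ℂ) - s - 1 = -s by ring, ← mul_assoc,
    mul_inv_cancel₀ (neg_ne_zero.2 hs0), one_mul]

/-- `h_L` in terms of `ζ`: `y^s (-s) ζ(1-s)/((s-1)⁵(s-ρ))` for `s ≠ ρ, 0`. [folklore] -/
theorem partL_eq_zeta {yv : ℝ} {ρ s : ℂ} (hζ' : riemannZeta₁ (1 - ρ) = 0) (hs : s ≠ ρ) (hs0 : s ≠ 0) :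
    partL yv ρ s = (yv : ℂ) ^ s * (-s * riemannZeta (1 - s)) / ((s - 1) ^ 5 * (s - ρ)) := by
  rw [partL_eq hζ' hs, riemannZeta₁_one_sub hs0]

/-- `h_L` is complex differentiable away from `s = 1` (for `y > 0`). [folklore] -/
theorem differentiableAt_partL {yv : ℝ} (hyv : 0 < yv) (ρ : ℂ) {s : ℂ} (hs : s ≠ 1) :
    DifferentiableAt ℂ (partL yv ρ) s := by
  unfold partL
  refine DifferentiableAt.div (DifferentiableAt.mul ?_ ?_) (by fun_prop)
    (pow_ne_zero _ (sub_ne_zero.2 hs))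
  · exact differentiableAt_id.const_cpow (Or.inl (by exact_mod_cast hyv.ne'))
  · exact differentiable_dslope (differentiable_riemannZeta₁.comp (by fun_prop)) ρ s

/-- **Decay of `h_L`**: for `y ≥ 1`, `re s ≤ 1`, `‖s‖ ≥ max 4 (2‖ρ‖)`:
`‖h_L(s)‖ ≤ 1024 y/‖s‖²`. [folklore] -/
theorem norm_partL_le {yv : ℝ} (hyv : 1 ≤ yv) {ρ : ℂ} (hζ' : riemannZeta₁ (1 - ρ) = 0)
    (hρ : ρ ≠ 0) {s : ℂ} (hs1 : s.re ≤ 1) (hs : max 4 (2 * ‖ρ‖) ≤ ‖s‖) :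
    ‖partL yv ρ s‖ ≤ 1024 * yv / ‖s‖ ^ 2 := by
  have h4 : 4 ≤ ‖s‖ := le_of_max_le_left hs
  have h2ρ : 2 * ‖ρ‖ ≤ ‖s‖ := le_of_max_le_right hs
  have hρpos : 0 < ‖ρ‖ := norm_pos_iff.2 hρ
  have hsρ : s ≠ ρ := by
    intro h; rw [h] at h2ρ; linarith
  have hspos : 0 < ‖s‖ := by linarith
  have hyv0 : 0 < yv := by linarith
  rw [partL_eq hζ' hsρ, norm_div, norm_mul, norm_mul, norm_pow, norm_cpow_eq_rpow_re_of_pos hyv0]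
  have hys : yv ^ s.re ≤ yv := by
    calc yv ^ s.re ≤ yv ^ (1 : ℝ) := Real.rpow_le_rpow_of_exponent_le hyv hs1
      _ = yv := Real.rpow_one yv
  have hζ1 : ‖riemannZeta₁ (1 - s)‖ ≤ (‖s‖ + 3) ^ 4 := by
    refine (norm_riemannZeta₁_le (by simp; linarith)).trans ?_
    have : ‖1 - s‖ ≤ ‖s‖ + 1 := (norm_sub_le _ _).trans (by simp; linarith)
    exact pow_le_pow_left₀ (by positivity) (by linarith) 4
  have hζ2 : (‖s‖ + 3) ^ 4 ≤ 16 * ‖s‖ ^ 4 := by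
    have : ‖s‖ + 3 ≤ 2 * ‖s‖ := by linarith
    calc (‖s‖ + 3) ^ 4 ≤ (2 * ‖s‖) ^ 4 := pow_le_pow_left₀ (by positivity) this 4
      _ = 16 * ‖s‖ ^ 4 := by ring
  have hsub : ‖s‖ / 2 ≤ ‖s - ρ‖ := by
    have h' : ‖s‖ - ‖ρ‖ ≤ ‖s - ρ‖ := by
      linarith [abs_norm_sub_norm_le s ρ, le_abs_self (‖s‖ - ‖ρ‖)]
    linarith
  have hsub1 : ‖s‖ / 2 ≤ ‖s - 1‖ := by
    have h' : ‖s‖ - ‖(1 : ℂ)‖ ≤ ‖s - 1‖ := by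
      linarith [abs_norm_sub_norm_le s 1, le_abs_self (‖s‖ - ‖(1 : ℂ)‖)]
    rw [norm_one] at h'
    linarith
  have hsρpos : 0 < ‖s - ρ‖ := by linarith
  have hs1pos : 0 < ‖s - 1‖ := by linarith
  rw [div_le_div_iff₀ (mul_pos (pow_pos hs1pos 5) hsρpos) (pow_pos hspos 2)]
  have key : (‖s‖ / 2) ^ 5 * (‖s‖ / 2) ≤ ‖s - 1‖ ^ 5 * ‖s - ρ‖ := by
    gcongr
  calc yv ^ s.re * ‖riemannZeta₁ (1 - s)‖ * ‖s‖ ^ 2 ≤ yv * (16 * ‖s‖ ^ 4) * ‖s‖ ^ 2 := by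
        gcongr; exact hζ1.trans hζ2
    _ = 1024 * yv * ((‖s‖ / 2) ^ 5 * (‖s‖ / 2)) := by ring
    _ ≤ 1024 * yv * (‖s - 1‖ ^ 5 * ‖s - ρ‖) := by gcongr

/-- `h_L` is integrable along every line `re s = σ < 1` (for `y ≥ 1`). [folklore] -/
theorem integrable_partL_line {yv : ℝ} (hyv : 1 ≤ yv) {ρ : ℂ} (hζ' : riemannZeta₁ (1 - ρ) = 0)
    (hρ : ρ ≠ 0) {σ : ℝ} (hσ : σ < 1) :
    Integrable fun y : ℝ ↦ partL yv ρ ((σ : ℂ) + y * I) := by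
  have hcont : Continuous fun y : ℝ ↦ partL yv ρ ((σ : ℂ) + y * I) :=
    continuous_line_of_differentiableAt σ fun y ↦ differentiableAt_partL (by linarith) ρ fun h ↦ by
      have := congrArg Complex.re h; simp at this; linarith
  refine integrable_of_continuous_of_norm_le hcont (T := max 4 (2 * ‖ρ‖)) (C := 2 * (1024 * yv))
    fun y hy ↦ ?_
  exact norm_le_inv_one_add_sq_of_le (by positivity) (le_trans (by norm_num) (le_max_left _ _))
    (fun hs ↦ norm_partL_le hyv hζ' hρ (by simp; linarith) hs) hy

/-- **Shifting `h_L` from the critical line to `re s = -1`** (no singularities in `re s < 1`).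
[folklore] -/
theorem integral_partL_half_eq_neg_one {yv : ℝ} (hyv : 1 ≤ yv) {ρ : ℂ}
    (hζ' : riemannZeta₁ (1 - ρ) = 0) (hρ : ρ.re = 1 / 2) :
    ∫ y : ℝ, partL yv ρ (((1 / 2 : ℝ) : ℂ) + y * I) = ∫ y : ℝ, partL yv ρ (((-1 : ℝ) : ℂ) + y * I) := by
  have hρ0 := ne_zero_of_re_eq_half hρ
  symm
  refine Literature.Analysis.Complex.integral_vertical_eq_of_differentiableOn (by norm_num) ?_
    (integrable_partL_line hyv hζ' hρ0 (by norm_num))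
    (integrable_partL_line hyv hζ' hρ0 (by norm_num)) ?_
  · intro s hs
    refine (differentiableAt_partL (by linarith) ρ fun h ↦ ?_).differentiableWithinAt
    have h1 : s.re ≤ 1 / 2 := hs.2
    rw [h, one_re] at h1
    norm_num at h1
  · exact horizontal_decay_of_le (le_trans (by norm_num) (le_max_left 4 (2 * ‖ρ‖)))
      fun s _ hb hs ↦ norm_partL_le hyv hζ' hρ0 (by linarith) hs

/-- The rational kernel `q_L(s) = s/((s-1)⁵(s-ρ))` of the left part. [folklore] -/
def qL (ρ : ℂ) (s : ℂ) : ℂ :=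
  s / ((s - 1) ^ 5 * (s - ρ))

/-- `q_L` is complex differentiable away from `1` and `ρ`. [folklore] -/
theorem differentiableAt_qL {ρ s : ℂ} (hs1 : s ≠ 1) (hsρ : s ≠ ρ) : DifferentiableAt ℂ (qL ρ) s := by
  unfold qL
  exact DifferentiableAt.div (by fun_prop) (by fun_prop)
    (mul_ne_zero (pow_ne_zero _ (sub_ne_zero.2 hs1)) (sub_ne_zero.2 hsρ))

/-- `q_L` is complex differentiable on `re s ≤ -1`. [folklore] -/
theorem differentiableOn_qL {ρ : ℂ} (hρ : ρ.re = 1 / 2) :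
    DifferentiableOn ℂ (qL ρ) {s : ℂ | s.re ≤ -1} := by
  intro s hs
  simp only [mem_setOf_eq] at hs
  have hs1 : s ≠ 1 := fun h ↦ by rw [h] at hs; simp at hs; linarith
  have hsρ : s ≠ ρ := fun h ↦ by rw [h, hρ] at hs; norm_num at hs
  exact (differentiableAt_qL hs1 hsρ).differentiableWithinAt

/-- `‖q_L(s)‖ ≤ 1/‖s‖²` on `re s ≤ -1`. [folklore] -/
theorem norm_qL_le {ρ : ℂ} (hρ : ρ.re = 1 / 2) {s : ℂ} (hs : s.re ≤ -1) :
    ‖qL ρ s‖ ≤ 1 / ‖s‖ ^ 2 := by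
  have hns : 1 ≤ ‖s‖ := by
    have := abs_re_le_norm s
    have h' : 1 ≤ |s.re| := by rw [abs_of_nonpos (by linarith)]; linarith
    linarith
  have hspos : 0 < ‖s‖ := by linarith
  have hsρ : 3 / 2 ≤ ‖s - ρ‖ := by
    have := abs_re_le_norm (s - ρ)
    rw [sub_re, hρ, abs_of_nonpos (by linarith)] at this
    linarith
  have h1 : ‖s‖ ≤ ‖s - 1‖ := by
    have e1 : ‖s‖ ^ 2 = s.re ^ 2 + s.im ^ 2 := by rw [Complex.sq_norm, Complex.normSq_apply]; ring
    have e2 : ‖s - 1‖ ^ 2 = (s.re - 1) ^ 2 + s.im ^ 2 := by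
      rw [Complex.sq_norm, Complex.normSq_apply]; simp; ring
    nlinarith [norm_nonneg (s - 1), norm_nonneg s]
  rw [qL, norm_div, norm_mul, norm_pow,
    div_le_div_iff₀ (mul_pos (pow_pos (by linarith) 5) (by linarith)) (pow_pos hspos 2), one_mul]
  have h5 : ‖s‖ ^ 5 ≤ ‖s - 1‖ ^ 5 := pow_le_pow_left₀ (norm_nonneg _) h1 5
  calc ‖s‖ * ‖s‖ ^ 2 = ‖s‖ ^ 3 := by ring
    _ ≤ ‖s‖ ^ 3 * (‖s‖ ^ 2 * (3 / 2)) := by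
        have : 1 ≤ ‖s‖ ^ 2 * (3 / 2) := by nlinarith
        nlinarith [pow_pos hspos 3]
    _ = ‖s‖ ^ 5 * (3 / 2) := by ring
    _ ≤ ‖s - 1‖ ^ 5 * ‖s - ρ‖ := by gcongr

/-- Arithmetic of the Dirichlet series of `ζ(1-s)`: `y^s (n+1)^s/(n+1) = … `; precisely
`q_L(s) · (-(1/(n+1)) (y(n+1))^s) = y^s (-s) (1/(n+1)^{1-s}) / ((s-1)⁵(s-ρ))`. [folklore] -/
lemma qL_term_eq {yv : ℝ} (hyv : 0 ≤ yv) (ρ s : ℂ) (n : ℕ) :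
    qL ρ s * (-(1 / ((n : ℂ) + 1)) * ((yv * (n + 1) : ℝ) : ℂ) ^ s) =
      (yv : ℂ) ^ s * (-s) * (1 / ((n : ℂ) + 1) ^ (1 - s)) / ((s - 1) ^ 5 * (s - ρ)) := by
  have hn : ((n : ℂ) + 1) ≠ 0 := by exact_mod_cast Nat.succ_ne_zero n
  have e1 : ((yv * (n + 1) : ℝ) : ℂ) ^ s = (yv : ℂ) ^ s * ((n : ℂ) + 1) ^ s := by
    rw [show ((yv * (n + 1) : ℝ) : ℂ) = (yv : ℂ) * ((n + 1 : ℝ) : ℂ) by push_cast; ring,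
      mul_cpow_ofReal_nonneg hyv (by positivity)]
    push_cast
    ring
  have e2 : 1 / ((n : ℂ) + 1) ^ (1 - s) = ((n : ℂ) + 1) ^ s / ((n : ℂ) + 1) := by
    rw [cpow_sub _ _ hn, cpow_one]
    field_simp
  rw [e1, e2, qL]
  field_simp

/-- **`h_L` on `re s = -1` as an absolutely convergent series**:
`h_L(s) = ∑_n q_L(s) · (-(1/(n+1)) (y(n+1))^s)`. [folklore] -/
theorem partL_neg_one_eq_tsum {yv : ℝ} (hyv : 0 < yv) {ρ : ℂ} (hζ' : riemannZeta₁ (1 - ρ) = 0)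
    (hρ : ρ.re = 1 / 2) (y : ℝ) :
    partL yv ρ (((-1 : ℝ) : ℂ) + y * I) =
      ∑' n : ℕ, qL ρ (((-1 : ℝ) : ℂ) + y * I) *
        (-(1 / ((n : ℂ) + 1)) * ((yv * (n + 1) : ℝ) : ℂ) ^ (((-1 : ℝ) : ℂ) + y * I)) := by
  set s : ℂ := ((-1 : ℝ) : ℂ) + y * I with hsdef
  have hsre : s.re = -1 := by simp [hsdef]
  have hsρ : s ≠ ρ := fun h ↦ by rw [h] at hsre; rw [hρ] at hsre; norm_num at hsre
  have hs0 : s ≠ 0 := fun h ↦ by rw [h] at hsre; simp at hsre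
  rw [partL_eq_zeta hζ' hsρ hs0,
    zeta_eq_tsum_one_div_nat_add_one_cpow (by simp [hsre])]
  simp_rw [qL_term_eq hyv.le]
  rw [tsum_div_const]
  congr 1
  rw [← tsum_mul_left, ← tsum_mul_left]
  exact tsum_congr fun n ↦ by ring

/-- The terms of the series for `h_L` on `re s = -1` are integrable, with summable
`L¹`-norms. [folklore] -/
theorem integrable_qL_mul {yv : ℝ} (hyv : 1 ≤ yv) {ρ : ℂ} (hρ : ρ.re = 1 / 2) (n : ℕ) :
    Integrable (fun y : ℝ ↦ qL ρ (((-1 : ℝ) : ℂ) + y * I) *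
      (-(1 / ((n : ℂ) + 1)) * ((yv * (n + 1) : ℝ) : ℂ) ^ (((-1 : ℝ) : ℂ) + y * I))) ∧
      ∫ y : ℝ, ‖qL ρ (((-1 : ℝ) : ℂ) + y * I) *
        (-(1 / ((n : ℂ) + 1)) * ((yv * (n + 1) : ℝ) : ℂ) ^ (((-1 : ℝ) : ℂ) + y * I))‖ ≤
        (1 / (yv * (n + 1) ^ 2)) * π := by
  have hx : 0 < yv * (n + 1) := by positivity
  have hn : ‖-(1 / ((n : ℂ) + 1))‖ = 1 / (n + 1) := by
    rw [norm_neg, norm_div, norm_one, show ((n : ℂ) + 1) = ((n + 1 : ℝ) : ℂ) by push_cast; ring,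
      Complex.norm_real, Real.norm_eq_abs, abs_of_pos (by positivity)]
  have hbound : ∀ y : ℝ, ‖qL ρ (((-1 : ℝ) : ℂ) + y * I) *
      (-(1 / ((n : ℂ) + 1)) * ((yv * (n + 1) : ℝ) : ℂ) ^ (((-1 : ℝ) : ℂ) + y * I))‖ ≤
      (1 / (yv * (n + 1) ^ 2)) * (1 + y ^ 2)⁻¹ := by
    intro y
    have hre : (((-1 : ℝ) : ℂ) + y * I).re = -1 := by simp
    rw [norm_mul, norm_mul, norm_cpow_eq_rpow_re_of_pos hx, hre, hn,
      Real.rpow_neg_one]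
    have hq := norm_qL_le hρ (s := ((-1 : ℝ) : ℂ) + y * I) (by rw [hre])
    have hns : ‖((-1 : ℝ) : ℂ) + y * I‖ ^ 2 = 1 + y ^ 2 := by
      rw [Complex.sq_norm, normSq_add_mul_I]; ring
    rw [hns] at hq
    calc ‖qL ρ (((-1 : ℝ) : ℂ) + y * I)‖ * (1 / (n + 1) * (yv * (n + 1))⁻¹)
        ≤ 1 / (1 + y ^ 2) * (1 / (n + 1) * (yv * (n + 1))⁻¹) := by gcongr
      _ = (1 / (yv * (n + 1) ^ 2)) * (1 + y ^ 2)⁻¹ := by field_simp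
  have hcont : Continuous fun y : ℝ ↦ qL ρ (((-1 : ℝ) : ℂ) + y * I) *
      (-(1 / ((n : ℂ) + 1)) * ((yv * (n + 1) : ℝ) : ℂ) ^ (((-1 : ℝ) : ℂ) + y * I)) := by
    refine Continuous.mul ?_ (Continuous.mul continuous_const ?_)
    · refine continuous_line_of_differentiableAt (-1) fun y ↦ differentiableAt_qL ?_ ?_
      · intro h; have := congrArg Complex.re h; simp at this; norm_num at this
      · intro h; have := congrArg Complex.re h; rw [hρ] at this; simp at this; norm_num at this
    · exact continuous_line_of_differentiableAt (-1) fun y ↦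
        differentiableAt_id.const_cpow (Or.inl (by exact_mod_cast hx.ne'))
  have hint := integrable_of_continuous_of_norm_le hcont (T := 0) fun y _ ↦ hbound y
  refine ⟨hint, ?_⟩
  calc ∫ y : ℝ, ‖qL ρ (((-1 : ℝ) : ℂ) + y * I) *
        (-(1 / ((n : ℂ) + 1)) * ((yv * (n + 1) : ℝ) : ℂ) ^ (((-1 : ℝ) : ℂ) + y * I))‖
      ≤ ∫ y : ℝ, (1 / (yv * (n + 1) ^ 2)) * (1 + y ^ 2)⁻¹ :=
        integral_mono hint.norm (integrable_inv_one_add_sq.const_mul _) hbound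
    _ = (1 / (yv * (n + 1) ^ 2)) * π := by rw [integral_const_mul, integral_univ_inv_one_add_sq]

/-- **`∫ h_L = 0` along the critical line** (`y ≥ 1`, `ζ₁(1-ρ) = 0`, `re ρ = 1/2`).
[cite: Burnol2002, Thm. 4.2 (proof)] -/
theorem integral_partL_eq_zero {yv : ℝ} (hyv : 1 ≤ yv) {ρ : ℂ}
    (hζ' : riemannZeta₁ (1 - ρ) = 0) (hρ : ρ.re = 1 / 2) :
    ∫ y : ℝ, partL yv ρ (((1 / 2 : ℝ) : ℂ) + y * I) = 0 := by
  have hyv0 : 0 < yv := by linarith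
  rw [integral_partL_half_eq_neg_one hyv hζ' hρ]
  simp_rw [partL_neg_one_eq_tsum hyv0 hζ' hρ]
  have hsum : Summable fun n : ℕ ↦ ∫ y : ℝ, ‖qL ρ (((-1 : ℝ) : ℂ) + y * I) *
      (-(1 / ((n : ℂ) + 1)) * ((yv * (n + 1) : ℝ) : ℂ) ^ (((-1 : ℝ) : ℂ) + y * I))‖ := by
    have h1 : Summable fun n : ℕ ↦ (1 / (yv * (n + 1) ^ 2)) * π := by
      have := (summable_nat_add_iff 1).2 (Real.summable_one_div_nat_pow.2 one_lt_two)
      simp only [Nat.cast_add, Nat.cast_one] at this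
      refine (this.mul_left (π / yv)).congr fun n ↦ ?_
      field_simp
    exact Summable.of_nonneg_of_le (fun n ↦ integral_nonneg fun y ↦ norm_nonneg _)
      (fun n ↦ (integrable_qL_mul hyv hρ n).2) h1
  rw [← integral_tsum_of_summable_integral_norm (fun n ↦ (integrable_qL_mul hyv hρ n).1) hsum]
  have h0 : ∀ n : ℕ, ∫ y : ℝ, qL ρ (((-1 : ℝ) : ℂ) + y * I) *
      (-(1 / ((n : ℂ) + 1)) * ((yv * (n + 1) : ℝ) : ℂ) ^ (((-1 : ℝ) : ℂ) + y * I)) = 0 := by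
    intro n
    have hx1 : 1 ≤ yv * (n + 1) := by nlinarith [n.cast_nonneg (α := ℝ)]
    have e : ∀ y : ℝ, qL ρ (((-1 : ℝ) : ℂ) + y * I) *
        (-(1 / ((n : ℂ) + 1)) * ((yv * (n + 1) : ℝ) : ℂ) ^ (((-1 : ℝ) : ℂ) + y * I)) =
        -(1 / ((n : ℂ) + 1)) * (qL ρ (((-1 : ℝ) : ℂ) + y * I) *
          ((yv * (n + 1) : ℝ) : ℂ) ^ (((-1 : ℝ) : ℂ) + y * I)) := fun y ↦ by ring
    simp_rw [e]
    rw [integral_const_mul, Literature.Analysis.Complex.integral_vertical_mul_cpow_eq_zero_of_one_le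
      (C := 1) (by norm_num) (differentiableOn_qL hρ) (fun s hs ↦ norm_qL_le hρ hs) hx1, mul_zero]
  simp_rw [h0]
  exact tsum_zero


/-! ## Orthogonality on the critical line -/

/-- `ζ₁` vanishes at the zeros of `ζ` other than `1`. [folklore] -/
theorem riemannZeta₁_eq_zero_of_zeta {ρ : ℂ} (hζ : riemannZeta ρ = 0) (hρ1 : ρ ≠ 1) :
    riemannZeta₁ ρ = 0 := by
  have := riemannZeta_eq_inv_sub_mul hρ1
  rw [hζ] at this
  rcases mul_eq_zero.1 this.symm with h | h
  · exact absurd h (inv_ne_zero (sub_ne_zero.2 hρ1))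
  · exact h

/-- Positive real bases: `((1/a)^s = a^{-s}`. [folklore] -/
lemma one_div_cpow_ofReal {a : ℝ} (ha : 0 < a) (s : ℂ) : ((1 / a : ℝ) : ℂ) ^ s = ((a : ℂ) ^ s)⁻¹ := by
  have harg : (a : ℂ).arg ≠ π := by
    rw [arg_ofReal_of_nonneg ha.le]; exact Real.pi_ne_zero.symm
  rw [one_div, ofReal_inv, inv_cpow _ _ harg]

/-- **The pointwise identity on the critical line.** For a zero `ρ = 1/2 + iγ` of `ζ`,
`s = 1/2 + iτ ≠ ρ`, `a > 0`, `λ > 0`: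
`(a^{-s} (-ζ(s)/s)) · k(s) = h_R(s) + (λ^ρ/V(ρ)) · h_L(s)` with `θ = 1/a`, `y = 1/(aλ)`
(functional equation `ζ(1-s) = gammaRatio(s) ζ(s)` and algebra). [cite: Burnol2002, Thm. 4.2 (proof)] -/
theorem mellin_fract_mul_burnolK_eq {γ : ℝ} (hζ : riemannZeta ((1 / 2 : ℂ) + γ * I) = 0) {τ : ℝ}
    (hτ : τ ≠ γ) {lam a : ℝ} (hlam : 0 < lam) (ha : 0 < a) :
    ((a : ℂ) ^ (-((1 / 2 : ℂ) + τ * I)) *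
        (-riemannZeta ((1 / 2 : ℂ) + τ * I) / ((1 / 2 : ℂ) + τ * I))) *
      burnolK ((1 / 2 : ℂ) + γ * I) lam ((1 / 2 : ℂ) + τ * I) =
    partR (1 / a) ((1 / 2 : ℂ) + γ * I) ((1 / 2 : ℂ) + τ * I) +
      ((lam : ℂ) ^ ((1 / 2 : ℂ) + γ * I) / burnolV ((1 / 2 : ℂ) + γ * I)) *
        partL (1 / (a * lam)) ((1 / 2 : ℂ) + γ * I) ((1 / 2 : ℂ) + τ * I) := by
  set s : ℂ := (1 / 2 : ℂ) + τ * I with hsdef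
  set ρ : ℂ := (1 / 2 : ℂ) + γ * I with hρdef
  have hs0 : s ≠ 0 := line_ne_zero τ
  have hs1 : s ≠ 1 := line_ne_one τ
  have hs1' : s - 1 ≠ 0 := sub_ne_zero.2 hs1
  have hsρ : s ≠ ρ := fun h ↦ hτ (by
    have := congrArg Complex.im h; simpa [hsdef, hρdef] using this)
  have hsρ' : s - ρ ≠ 0 := sub_ne_zero.2 hsρ
  have hρ1 : ρ ≠ 1 := line_ne_one γ
  have hρre : ρ.re = 1 / 2 := by simp [hρdef]
  have hVρ : burnolV ρ ≠ 0 := burnolV_ne_zero (by simp [hρdef]) (by simp [hρdef]; norm_num)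
  have hζ1 : riemannZeta₁ ρ = 0 := riemannZeta₁_eq_zero_of_zeta hζ hρ1
  have hζ1' : riemannZeta₁ (1 - ρ) = 0 := riemannZeta₁_one_sub_eq_zero hζ1 hρre
  -- cpow bookkeeping
  have hA : (a : ℂ) ^ s ≠ 0 := fun h ↦ by
    rw [cpow_eq_zero_iff] at h; exact (ofReal_ne_zero.2 ha.ne') h.1
  have hL : (lam : ℂ) ^ s ≠ 0 := fun h ↦ by
    rw [cpow_eq_zero_iff] at h; exact (ofReal_ne_zero.2 hlam.ne') h.1
  have e1 : (a : ℂ) ^ (-s) = ((a : ℂ) ^ s)⁻¹ := cpow_neg _ _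
  have e2 : ((1 / a : ℝ) : ℂ) ^ s = ((a : ℂ) ^ s)⁻¹ := one_div_cpow_ofReal ha s
  have e3 : ((1 / (a * lam) : ℝ) : ℂ) ^ s = ((a : ℂ) ^ s)⁻¹ * ((lam : ℂ) ^ s)⁻¹ := by
    rw [show (1 / (a * lam) : ℝ) = (1 / a) * (1 / lam) by field_simp,
      show (((1 / a) * (1 / lam) : ℝ) : ℂ) = ((1 / a : ℝ) : ℂ) * ((1 / lam : ℝ) : ℂ) by push_cast; ring,
      mul_cpow_ofReal_nonneg (by positivity) (by positivity), one_div_cpow_ofReal ha,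
      one_div_cpow_ofReal hlam]
  have e4 : (lam : ℂ) ^ (ρ - s) = (lam : ℂ) ^ ρ / (lam : ℂ) ^ s :=
    cpow_sub _ _ (ofReal_ne_zero.2 hlam.ne')
  -- the functional equation on the line
  have hFE : riemannZeta (1 - s) = gammaRatio s * riemannZeta s :=
    riemannZeta_one_sub_eq (by simp [hsdef]) (by simp [hsdef]; norm_num)
  have hVs : burnolV s = gammaRatio s * (s / (s - 1)) ^ 6 := rfl
  rw [partR_eq_zeta hζ1 hsρ hs1, partL_eq_zeta hζ1' hsρ hs0, burnolK, burnolR, hVs, e1, e2, e3, e4,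
    hFE]
  field_simp
  ring

/-- A single point is Lebesgue-null: `τ ≠ γ` for a.e. `τ`. [folklore] -/
lemma ae_ne (γ : ℝ) : ∀ᵐ τ : ℝ, τ ≠ γ := by
  simp [ae_iff]

/-- Cast bookkeeping: `((1/2 : ℝ) : ℂ) = 1/2`. [folklore] -/
lemma ofReal_one_half : ((1 / 2 : ℝ) : ℂ) = 1 / 2 := by push_cast; ring

/-- **Integrability of `𝓜[{1/(at)}](s) · k(s)` on the critical line** (it is a.e.
`h_R + (λ^ρ/V(ρ)) h_L`). [folklore] -/
theorem integrable_mellin_fract_mul_burnolK {γ : ℝ} (hζ : riemannZeta ((1 / 2 : ℂ) + γ * I) = 0)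
    {lam a : ℝ} (hlam : 0 < lam) (ha : 1 ≤ a) (ha' : a ≤ 1 / lam) :
    Integrable fun τ : ℝ ↦ ((a : ℂ) ^ (-((1 / 2 : ℂ) + τ * I)) *
        (-riemannZeta ((1 / 2 : ℂ) + τ * I) / ((1 / 2 : ℂ) + τ * I))) *
      burnolK ((1 / 2 : ℂ) + γ * I) lam ((1 / 2 : ℂ) + τ * I) := by
  set ρ : ℂ := (1 / 2 : ℂ) + γ * I with hρdef
  have ha0 : 0 < a := by linarith
  have hρ1 : ρ ≠ 1 := line_ne_one γ
  have hρre : ρ.re = 1 / 2 := by simp [hρdef]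
  have hρ0 : ρ ≠ 0 := line_ne_zero γ
  have hζ1 : riemannZeta₁ ρ = 0 := riemannZeta₁_eq_zero_of_zeta hζ hρ1
  have hζ1' : riemannZeta₁ (1 - ρ) = 0 := riemannZeta₁_one_sub_eq_zero hζ1 hρre
  have hθ : 0 < 1 / a := by positivity
  have hθ1 : 1 / a ≤ 1 := by rw [div_le_one ha0]; exact ha
  have hy : 1 ≤ 1 / (a * lam) := by
    rw [le_div_iff₀ (by positivity), one_mul]
    calc a * lam ≤ (1 / lam) * lam := by gcongr
      _ = 1 := by field_simp
  have h1 := integrable_partR_line hθ hθ1 hζ1 hρ0 (σ := 1 / 2) (by norm_num)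
  have h2 := integrable_partL_line hy hζ1' hρ0 (σ := 1 / 2) (by norm_num)
  simp only [ofReal_one_half] at h1 h2
  refine (h1.add (h2.const_mul ((lam : ℂ) ^ ρ / burnolV ρ))).congr ?_
  filter_upwards [ae_ne γ] with τ hτ
  exact (mellin_fract_mul_burnolK_eq hζ hτ hlam ha0).symm

/-- **Orthogonality (Burnol, Thm. 4.2 / Cor. 4.3 for `k = 0`, on the Mellin side).** For a zero
`ρ = 1/2 + iγ` of `ζ` on the critical line, `0 < λ` and `1 ≤ a ≤ 1/λ`:
`∫ a^{-s} (-ζ(s)/s) · burnolK ρ λ s dτ = 0` (`s = 1/2 + iτ`); here `a^{-s}(-ζ(s)/s)` is the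
Mellin transform of the Beurling function `t ↦ {1/(at)}` (Titchmarsh (2.1.5)), so by the Parseval
pairing of `NymanBeurlingVectors.lean` the vector `𝓜⁻¹(conj ∘ burnolK ρ λ)` is orthogonal in
`L²(0,∞)` to every generator of `𝓑_λ`. [cite: Burnol2002, Thm. 4.2 and Cor. 4.3] -/
theorem integral_mellin_fract_mul_burnolK_eq_zero {γ : ℝ}
    (hζ : riemannZeta ((1 / 2 : ℂ) + γ * I) = 0) {lam a : ℝ} (hlam : 0 < lam) (ha : 1 ≤ a)
    (ha' : a ≤ 1 / lam) :
    ∫ τ : ℝ, ((a : ℂ) ^ (-((1 / 2 : ℂ) + τ * I)) *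
        (-riemannZeta ((1 / 2 : ℂ) + τ * I) / ((1 / 2 : ℂ) + τ * I))) *
      burnolK ((1 / 2 : ℂ) + γ * I) lam ((1 / 2 : ℂ) + τ * I) = 0 := by
  set ρ : ℂ := (1 / 2 : ℂ) + γ * I with hρdef
  have ha0 : 0 < a := by linarith
  have hρ1 : ρ ≠ 1 := line_ne_one γ
  have hρre : ρ.re = 1 / 2 := by simp [hρdef]
  have hρ0 : ρ ≠ 0 := line_ne_zero γ
  have hζ1 : riemannZeta₁ ρ = 0 := riemannZeta₁_eq_zero_of_zeta hζ hρ1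
  have hζ1' : riemannZeta₁ (1 - ρ) = 0 := riemannZeta₁_one_sub_eq_zero hζ1 hρre
  have hθ : 0 < 1 / a := by positivity
  have hθ1 : 1 / a ≤ 1 := by rw [div_le_one ha0]; exact ha
  have hy : 1 ≤ 1 / (a * lam) := by
    rw [le_div_iff₀ (by positivity), one_mul]
    calc a * lam ≤ (1 / lam) * lam := by gcongr
      _ = 1 := by field_simp
  have h1 := integrable_partR_line hθ hθ1 hζ1 hρ0 (σ := 1 / 2) (by norm_num)
  have h2 := integrable_partL_line hy hζ1' hρ0 (σ := 1 / 2) (by norm_num)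
  have h3 := integral_partR_eq_zero hθ hθ1 hζ1 hρre
  have h4 := integral_partL_eq_zero hy hζ1' hρre
  simp only [ofReal_one_half] at h1 h2 h3 h4
  calc ∫ τ : ℝ, ((a : ℂ) ^ (-((1 / 2 : ℂ) + τ * I)) *
        (-riemannZeta ((1 / 2 : ℂ) + τ * I) / ((1 / 2 : ℂ) + τ * I))) * burnolK ρ lam ((1 / 2 : ℂ) + τ * I)
      = ∫ τ : ℝ, (partR (1 / a) ρ ((1 / 2 : ℂ) + τ * I) +
          ((lam : ℂ) ^ ρ / burnolV ρ) * partL (1 / (a * lam)) ρ ((1 / 2 : ℂ) + τ * I)) := by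
        refine integral_congr_ae ?_
        filter_upwards [ae_ne γ] with τ hτ
        exact mellin_fract_mul_burnolK_eq hζ hτ hlam ha0
    _ = 0 := by
        rw [integral_add h1 (h2.const_mul _), integral_const_mul, h3, h4, mul_zero, add_zero]

end BurnolVectors

end Literature.NumberTheory.LFunctions
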